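import Summits.QuantumFields.BalabanUV.Beta.MultiscaleDistance

/-!
# Beta / MultiscaleDistanceGraded — LIPSCHITZ DATA ALONG THE SCALE-ADAPTED DISTANCE, GRADED SCALES, AND THE TARGET-SCALE PREFACTOR
# (MODEL; O.2 item (ii): the region-geometry clause of [B6] (2.1)–(2.2) as a Lipschitz hypothesis, and what it buys for (3.42)'s shape)

(K) `MultiscaleDistance` gives the scale-adapted distance `d_n` for a FREE site scale `n`.  Print's geometry is not free: by [B6]
(2.1)–(2.2) each layer `Λ_j` is a union of big blocks at least `RM` blocks wide, and neighbouring layers carry neighbouring scales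
`L^jη`, `L^{j±1}η` — so the scale exponent changes by at most one per `≍ R` units of the distance `d(y, y′)`.  This module types that
clause as DATA-LEVEL Lipschitz hypotheses and proves what they buy: §1 any bondwise-Lipschitz function is `d_n`-Lipschitz
(`abs_sub_le_sdist_div`); §2 GRADED SCALES `n = L^e` with `|e(b₊) − e(b₋)| ≤ slen(b)/R` ⟹ `n(y) ≤ n(x)·e^{(log L/R)·d_n(x,y)}`
(`scale_le_scale_mul_exp`) and THE PREFACTOR EXCHANGE `e^{−κd}·n(x)n(y) ≤ e^{−(κ − log L/R)d}·n(x)²` (`prefactor_exchange`): the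
symmetric local prefactor `n(x)·n(y)` of `MultiscaleDecay.decay_levelOp` becomes (3.42)'s ONE-SIDED target-scale prefactor `(L^jη)²` at
the cost `log L/R` of rate — the MODEL form of «M sufficiently large» absorbing powers of `L` per scale change; §3 the torus bond graph is
connected (`reachable_torus`), so on `UT N` the reachability provisos are void
(unit `b2b-balaban-beta-d4-p2`, GEN 8, MODEL crew; claim «MULTISCALE-DECAY-MODEL» journal l.18614∕l.19202; over (K) p229994).

HONEST FRAMING: discharging `BetaPertH` makes Bałaban's UV stability UNCONDITIONAL — NOT the continuum limit, NOT the Clay problem.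
HONEST DEPENDENCY (verbatim): «continuum YM on T⁴ ⇐ BetaPertH ∧ nine spine estimates (0/9 proved); BetaPertH ⇐ (D1) ∧ (D4) ∧ CAP+tail;
G-an2-4 gates asym, D1 and NE2/3/4.»  THIS MODULE DISCHARGES NOTHING of `BetaPertH`, asserts NOTHING printed and cites nothing as a fact
(ABSOLUTE RULE): [folklore] graph-metric bookkeeping; the scale `n`, the exponent `e`, the base `L` and the thickness `R` are DATA, and the
graded hypothesis is the SHAPE of [B6] (2.1)–(2.2) ∕ [B9] p. 396 («for each cube □ of this class there exists a unique index j …»), not a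
statement about Bałaban's domains.  NOT here: the within-scale ℓ² → ℓ^∞ step of (3.42) (print: [B6] (2.41)–(2.43) from [B5] Lemmas 2.2,
2.4, Prop. 2.3) — the entry bound summed over a source cube still loses `#cube`; that is item (ii-b).  LOCI (shape only): [B6] =
`Balaban1984PropagatorsII` (2.1)–(2.2) p. 224, (2.46) p. 231; [B9] = `Balaban1985BackgroundPropagators` (3.35)–(3.36) p. 396, Thm 3.1 (3.42)
p. 397.  No class change on row D4 (critical-path width 0; D4 DISCHARGE NO DATE); NOT BetaPertH, NOT continuum, NOT Clay, NOT summit progress.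

v1.1 (GEN 8, after t4-ne9-formalise-leaf-04-g28's LOCATED OBJECTION O-ne9leaf04g28-1 «RIGID GRADING», journal l.19783, ADOPTED): §2's
bondwise clause `|e(b₊) − e(b₋)| ≤ slen(b)/R` with an ℕ-valued exponent and `R > 1` forces `e(b₊) = e(b₋)` on every bond (`slen ≤ 1`), hence
CONSTANT scales along reachability classes — on the torus §2's exchange is then the identity; print's layers are a STEP function (one jump
across ONE interface bond, then constant for `≥ RM` big blocks), whose correct two-point model is the ADDITIVE datum
`|e(x) − e(y)| ≤ A + d_n(x,y)/R` (A = 1 in print).  NEW §4 proves the additive twins **`scale_le_scale_mul_exp_add`**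
(`n(y) ≤ L^A·n(x)·e^{(log L/R)·d_n(x,y)}`, no reachability proviso), **`prefactor_exchange_add`** (`e^{−κd}·n(x)n(y) ≤ L^A·e^{−(κ − log L/R)d}·n(x)²`
— the owner's `prefactor_transfer` shape with `C = L^A`), `decay_bound_exchange_add`, and `additive_of_bondwise` (the landed clause is the
`A = 0` case on a reachability class).  §1 (real-valued `g`) and §3 are unaffected; §2 stays TRUE (and vacuous beyond constant scales on `UT N`).
-/

namespace Summit.QuantumFields.BalabanUV.Beta.MultiscaleDistanceGraded

open Finset Function
open Summit.QuantumFields.BalabanUV.Beta.MultiscaleDistance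
open Literature.MathematicalPhysics.QuantumFieldTheory.Balaban1983to89
open Literature.MathematicalPhysics.QuantumFieldTheory.Balaban1983to89.B9Thm37GluePU (bsrc btgt bsrc_apply btgt_apply)
open Literature.MathematicalPhysics.QuantumFieldTheory.Balaban1983to89.B5Leibniz121 (up)
open B5TorusCover (UT)

noncomputable section

/-! ## §1 Bondwise-Lipschitz functions are Lipschitz for the scale-adapted distance -/

section Lipschitz

variable {St Bd : Type} (src tgt : Bd → St) (n : St → ℕ)

/-- A function whose steps across bonds are bounded by `slen/R` changes by at most `wlen(p)/R` along any walk `p`. [folklore] -/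
theorem abs_sub_le_wlen_div (g : St → ℝ) {R : ℝ} (hR : 0 < R)
    (hg : ∀ b, |g (tgt b) - g (src b)| ≤ slen n (src b) (tgt b) / R) :
    ∀ {x y : St} (p : (bondGraph src tgt).Walk x y), |g x - g y| ≤ wlen src tgt n p / R
  | _, _, SimpleGraph.Walk.nil => by simp [wlen_nil]
  | x, y, @SimpleGraph.Walk.cons _ _ _ z _ h p => by
      rw [wlen_cons, add_div]
      have hstep : |g x - g z| ≤ slen n x z / R := by
        have h' := h
        rw [bondGraph, SimpleGraph.fromRel_adj] at h'
        obtain ⟨_, ⟨b, hb1, hb2⟩ | ⟨b, hb1, hb2⟩⟩ := h'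
        · have := hg b
          rw [hb1, hb2, abs_sub_comm] at this
          exact this
        · have := hg b
          rw [hb1, hb2, slen_comm] at this
          exact this
      calc |g x - g y| = |(g x - g z) + (g z - g y)| := by ring_nf
        _ ≤ |g x - g z| + |g z - g y| := abs_add_le _ _
        _ ≤ slen n x z / R + wlen src tgt n p / R := add_le_add hstep (abs_sub_le_wlen_div g hR hg p)

/-- **Bondwise Lipschitz ⟹ `d_n`-Lipschitz**: `|g(b₊) − g(b₋)| ≤ slen(b)/R` on every bond and `x, y` in one reachability class ⟹
`|g(x) − g(y)| ≤ d_n(x, y)/R`. [folklore] -/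
theorem abs_sub_le_sdist_div (g : St → ℝ) {R : ℝ} (hR : 0 < R)
    (hg : ∀ b, |g (tgt b) - g (src b)| ≤ slen n (src b) (tgt b) / R) {x y : St} (hxy : (bondGraph src tgt).Reachable x y) :
    |g x - g y| ≤ sdist src tgt n x y / R := by
  haveI : Nonempty ((bondGraph src tgt).Walk x y) := hxy
  have h : |g x - g y| * R ≤ sdist src tgt n x y :=
    le_ciInf fun p => (le_div_iff₀ hR).mp (abs_sub_le_wlen_div src tgt n g hR hg p)
  exact (le_div_iff₀ hR).mpr h

end Lipschitz

/-! ## §2 Graded scales: the prefactor exchange -/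

section Graded

variable {St Bd : Type} (src tgt : Bd → St) (n : St → ℕ)

/-- **GRADED SCALES**: `n = L^e` with a scale exponent `e` changing by at most `slen(b)/R` per bond (the SHAPE of [B6] (2.1)–(2.2):
a layer of scale `L^j` is at least `≍ R` units of `d_n` thick) ⟹ along one reachability class the scales compare as
`n(y) ≤ n(x)·e^{(log L/R)·d_n(x, y)}`. [cite: Balaban1984PropagatorsII, (2.1)-(2.2) p.224 + (2.46) p.231] -/
theorem scale_le_scale_mul_exp {L : ℕ} (hL : 1 ≤ L) (e : St → ℕ) (hn : ∀ x, n x = L ^ e x) {R : ℝ} (hR : 0 < R)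
    (hgr : ∀ b, |(e (tgt b) : ℝ) - e (src b)| ≤ slen n (src b) (tgt b) / R) {x y : St}
    (hxy : (bondGraph src tgt).Reachable x y) :
    (n y : ℝ) ≤ n x * Real.exp (Real.log L / R * sdist src tgt n x y) := by
  have hL0 : (0 : ℝ) < L := by exact_mod_cast hL
  have hlogL : 0 ≤ Real.log L := Real.log_nonneg (by exact_mod_cast hL)
  have hlip := abs_sub_le_sdist_div src tgt n (fun z => (e z : ℝ)) hR hgr hxy
  have hey : (e y : ℝ) ≤ e x + sdist src tgt n x y / R := by
    have := (abs_sub_le_iff.mp hlip).2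
    linarith
  have hnx : (n x : ℝ) = (L : ℝ) ^ (e x : ℝ) := by rw [hn x, Nat.cast_pow, Real.rpow_natCast]
  have hny : (n y : ℝ) = (L : ℝ) ^ (e y : ℝ) := by rw [hn y, Nat.cast_pow, Real.rpow_natCast]
  rw [hnx, hny]
  calc (L : ℝ) ^ (e y : ℝ) ≤ (L : ℝ) ^ ((e x : ℝ) + sdist src tgt n x y / R) :=
        Real.rpow_le_rpow_of_exponent_le (by exact_mod_cast hL) hey
    _ = (L : ℝ) ^ (e x : ℝ) * (L : ℝ) ^ (sdist src tgt n x y / R) := Real.rpow_add hL0 _ _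
    _ = (L : ℝ) ^ (e x : ℝ) * Real.exp (Real.log L / R * sdist src tgt n x y) := by
        congr 1
        rw [Real.rpow_def_of_pos hL0]
        congr 1
        ring

/-- **THE PREFACTOR EXCHANGE**: under graded scales the symmetric local prefactor `n(x)·n(y)` of an entry bound `e^{−κd_n(x,y)}·n(x)n(y)`
is traded for the ONE-SIDED target-scale prefactor `n(x)²` at the cost `log L/R` of rate:
`e^{−κd_n(x,y)}·n(x)·n(y) ≤ e^{−(κ − log L/R)·d_n(x,y)}·n(x)²` — the SHAPE of (3.42)'s `(L^jη)²`, `j` = the scale at the target.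
[cite: Balaban1985BackgroundPropagators, Thm 3.1 (3.42) p.397; Balaban1984PropagatorsII, (2.1)-(2.2) p.224] -/
theorem prefactor_exchange {L : ℕ} (hL : 1 ≤ L) (e : St → ℕ) (hn : ∀ x, n x = L ^ e x) {R : ℝ} (hR : 0 < R)
    (hgr : ∀ b, |(e (tgt b) : ℝ) - e (src b)| ≤ slen n (src b) (tgt b) / R) (κ : ℝ) {x y : St}
    (hxy : (bondGraph src tgt).Reachable x y) :
    Real.exp (-(κ * sdist src tgt n x y)) * ((n x : ℝ) * n y) ≤
      Real.exp (-((κ - Real.log L / R) * sdist src tgt n x y)) * (n x : ℝ) ^ 2 := by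
  have hscale := scale_le_scale_mul_exp src tgt n hL e hn hR hgr hxy
  have hnx0 : (0 : ℝ) ≤ n x := Nat.cast_nonneg _
  have hexp0 : 0 ≤ Real.exp (-(κ * sdist src tgt n x y)) := (Real.exp_pos _).le
  calc Real.exp (-(κ * sdist src tgt n x y)) * ((n x : ℝ) * n y)
      ≤ Real.exp (-(κ * sdist src tgt n x y)) * ((n x : ℝ) * (n x * Real.exp (Real.log L / R * sdist src tgt n x y))) :=
        mul_le_mul_of_nonneg_left (mul_le_mul_of_nonneg_left hscale hnx0) hexp0
    _ = Real.exp (-(κ * sdist src tgt n x y)) * Real.exp (Real.log L / R * sdist src tgt n x y) * (n x : ℝ) ^ 2 := by ring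
    _ = Real.exp (-((κ - Real.log L / R) * sdist src tgt n x y)) * (n x : ℝ) ^ 2 := by
        rw [← Real.exp_add]
        congr 1
        congr 1
        ring

/-- The same exchange applied to a decay bound with a positive denominator: any `|G| ≤ e^{−κd}·n(x)n(y)/μ` becomes
`|G| ≤ e^{−(κ − log L/R)d}·n(x)²/μ`. [folklore] -/
theorem decay_bound_exchange {L : ℕ} (hL : 1 ≤ L) (e : St → ℕ) (hn : ∀ x, n x = L ^ e x) {R : ℝ} (hR : 0 < R)
    (hgr : ∀ b, |(e (tgt b) : ℝ) - e (src b)| ≤ slen n (src b) (tgt b) / R) (κ : ℝ) {μ : ℝ} (hμ : 0 < μ) {x y : St}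
    (hxy : (bondGraph src tgt).Reachable x y) {G : ℝ}
    (hG : G ≤ Real.exp (-(κ * sdist src tgt n x y)) * ((n x : ℝ) * n y) / μ) :
    G ≤ Real.exp (-((κ - Real.log L / R) * sdist src tgt n x y)) * (n x : ℝ) ^ 2 / μ :=
  hG.trans (div_le_div_of_nonneg_right (prefactor_exchange src tgt n hL e hn hR hgr κ hxy) hμ.le)

end Graded

/-! ## §3 The torus bond graph is connected -/

section Torus

variable {d : ℕ} {N : Fin d → ℕ} [∀ i, NeZero (N i)]

/-- One `up` step is a bond, hence reachable. [folklore] -/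
theorem reachable_up (x : UT N) (μ : Fin d) : (bondGraph (bsrc (N := N)) btgt).Reachable x (up x μ) := by
  by_cases h : x = up x μ
  · rw [← h]
  · have hb := (adj_of_bond (bsrc (N := N)) btgt (x, μ) (by simpa using h)).1
    simpa using hb.reachable

/-- Iterated `up` steps are reachable. [folklore] -/
theorem reachable_iterate_up (x : UT N) (μ : Fin d) (m : ℕ) :
    (bondGraph (bsrc (N := N)) btgt).Reachable x ((fun z => up z μ)^[m] x) := by
  induction m with
  | zero => exact SimpleGraph.Reachable.refl _
  | succ m ih =>
      rw [Function.iterate_succ_apply']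
      exact ih.trans (reachable_up _ μ)

/-- In `Fin n`, `(m • 1).val = m % n`. [folklore] -/
theorem val_nsmul_one {n : ℕ} [NeZero n] (m : ℕ) : ((m • (1 : Fin n) : Fin n) : ℕ) = m % n := by
  induction m with
  | zero => simp
  | succ m ih => rw [succ_nsmul, Fin.val_add, ih, Fin.val_one', ← Nat.add_mod]

/-- In `Fin n`, `k.val • 1 = k`. [folklore] -/
theorem val_nsmul_one_eq {n : ℕ} [NeZero n] (k : Fin n) : (k : ℕ) • (1 : Fin n) = k :=
  Fin.ext (by rw [val_nsmul_one, Nat.mod_eq_of_lt k.2])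

/-- `m` steps of `up` along `μ` add `m • 1` to the `μ`-coordinate. [folklore] -/
theorem iterate_up_eq (x : UT N) (μ : Fin d) (m : ℕ) :
    (fun z => up z μ)^[m] x = UT.ofSite N (Function.update (UT.toSite N x) μ (UT.toSite N x μ + m • (1 : Fin (N μ)))) := by
  induction m with
  | zero =>
      rw [Function.iterate_zero, id, zero_nsmul, add_zero, Function.update_eq_self]
      rfl
  | succ m ih =>
      rw [Function.iterate_succ_apply', ih, succ_nsmul, ← add_assoc]
      show UT.ofSite N (Function.update _ μ _) = _
      congr 1
      funext i
      by_cases hi : i = μ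
      · subst hi
        simp [UT.toSite, UT.ofSite]
      · simp [UT.toSite, UT.ofSite, Function.update_of_ne hi]

/-- Any value of one coordinate is reachable. [folklore] -/
theorem reachable_update (x : UT N) (μ : Fin d) (t : Fin (N μ)) :
    (bondGraph (bsrc (N := N)) btgt).Reachable x (UT.ofSite N (Function.update (UT.toSite N x) μ t)) := by
  have h := reachable_iterate_up x μ ((t - UT.toSite N x μ : Fin (N μ)) : ℕ)
  rw [iterate_up_eq, val_nsmul_one_eq, add_sub_cancel] at h
  exact h

/-- **The torus bond graph is connected**: every two sites of `UT N` are joined by a walk of bonds `(x, μ)`. [folklore] -/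
theorem reachable_torus (x y : UT N) : (bondGraph (bsrc (N := N)) btgt).Reachable x y := by
  classical
  -- change the coordinates of `x` into those of `y` one axis at a time
  have key : ∀ s : Finset (Fin d), (bondGraph (bsrc (N := N)) btgt).Reachable x
      (UT.ofSite N fun i => if i ∈ s then UT.toSite N y i else UT.toSite N x i) := by
    intro s
    induction s using Finset.induction_on with
    | empty =>
        have : (UT.ofSite N fun i => if i ∈ (∅ : Finset (Fin d)) then UT.toSite N y i else UT.toSite N x i) = x := by
          simp only [Finset.notMem_empty, if_false]
          rfl
        rw [this]
    | insert a s ha ih =>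
        refine ih.trans ?_
        have e : (UT.ofSite N fun i => if i ∈ insert a s then UT.toSite N y i else UT.toSite N x i) =
            UT.ofSite N (Function.update
              (UT.toSite N (UT.ofSite N fun i => if i ∈ s then UT.toSite N y i else UT.toSite N x i)) a (UT.toSite N y a)) := by
          show UT.ofSite N _ = UT.ofSite N _
          congr 1
          funext i
          by_cases hi : i = a
          · subst hi
            simp [UT.toSite, UT.ofSite]
          · simp [UT.toSite, UT.ofSite, Finset.mem_insert, hi]
        rw [e]
        exact reachable_update _ a _
  have hfin := key Finset.univ
  have e : (UT.ofSite N fun i => if i ∈ (Finset.univ : Finset (Fin d)) then UT.toSite N y i else UT.toSite N x i) = y := by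
    simp only [Finset.mem_univ, if_true]
    rfl
  rw [e] at hfin
  exact hfin

/-- Hence on the torus `d_n` dominates the graph distance over `n_max` WITH a genuine graph distance (every pair is reachable), and the
graded-scale exchange holds for EVERY pair of sites. [folklore] -/
theorem prefactor_exchange_torus (n : UT N → ℕ) {L : ℕ} (hL : 1 ≤ L) (e : UT N → ℕ) (hn : ∀ x, n x = L ^ e x) {R : ℝ}
    (hR : 0 < R) (hgr : ∀ b, |(e (btgt b) : ℝ) - e (bsrc b)| ≤ slen n (bsrc b) (btgt b) / R) (κ : ℝ) (x y : UT N) :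
    Real.exp (-(κ * sdist bsrc btgt n x y)) * ((n x : ℝ) * n y) ≤
      Real.exp (-((κ - Real.log L / R) * sdist bsrc btgt n x y)) * (n x : ℝ) ^ 2 :=
  prefactor_exchange bsrc btgt n hL e hn hR hgr κ (reachable_torus x y)

end Torus

/-! ## §4 (v1.1) The ADDITIVE grading: the step-function geometry of [B6] (2.1)–(2.2) -/

section Additive

variable {St Bd : Type} (src tgt : Bd → St) (n : St → ℕ)

/-- **ADDITIVE GRADED SCALES**: `n = L^e` and the two-point datum `|e(x) − e(y)| ≤ A + d_n(x,y)/R` (one scale change per `≍ R` units of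
distance, up to `A` free jumps — the SHAPE of [B6] (2.1)–(2.2)'s step geometry, `A = 1`) ⟹ `n(y) ≤ L^A·n(x)·e^{(log L/R)·d_n(x,y)}`; no
reachability proviso. [cite: Balaban1984PropagatorsII, (2.1)-(2.2) p.224 + (2.46) p.231] -/
theorem scale_le_scale_mul_exp_add {L : ℕ} (hL : 1 ≤ L) (e : St → ℕ) (hn : ∀ x, n x = L ^ e x) {R : ℝ} {A : ℕ}
    {x y : St} (hadd : |(e x : ℝ) - e y| ≤ A + sdist src tgt n x y / R) :
    (n y : ℝ) ≤ (L : ℝ) ^ A * n x * Real.exp (Real.log L / R * sdist src tgt n x y) := by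
  have hL0 : (0 : ℝ) < L := by exact_mod_cast hL
  have hL1 : (1 : ℝ) ≤ L := by exact_mod_cast hL
  have hey : (e y : ℝ) ≤ (A : ℝ) + e x + sdist src tgt n x y / R := by
    have := (abs_sub_le_iff.mp hadd).2
    linarith
  have hnx : (n x : ℝ) = (L : ℝ) ^ (e x : ℝ) := by rw [hn x, Nat.cast_pow, Real.rpow_natCast]
  have hny : (n y : ℝ) = (L : ℝ) ^ (e y : ℝ) := by rw [hn y, Nat.cast_pow, Real.rpow_natCast]
  have hLA : (L : ℝ) ^ A = (L : ℝ) ^ (A : ℝ) := (Real.rpow_natCast _ _).symm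
  rw [hnx, hny, hLA]
  calc (L : ℝ) ^ (e y : ℝ) ≤ (L : ℝ) ^ ((A : ℝ) + (e x : ℝ) + sdist src tgt n x y / R) :=
        Real.rpow_le_rpow_of_exponent_le hL1 hey
    _ = (L : ℝ) ^ (A : ℝ) * (L : ℝ) ^ (e x : ℝ) * (L : ℝ) ^ (sdist src tgt n x y / R) := by
        rw [Real.rpow_add hL0, Real.rpow_add hL0]
    _ = (L : ℝ) ^ (A : ℝ) * (L : ℝ) ^ (e x : ℝ) * Real.exp (Real.log L / R * sdist src tgt n x y) := by
        congr 1
        rw [Real.rpow_def_of_pos hL0]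
        congr 1
        ring

/-- **THE ADDITIVE PREFACTOR EXCHANGE**: `e^{−κd_n(x,y)}·n(x)n(y) ≤ L^A·e^{−(κ − log L/R)·d_n(x,y)}·n(x)²` — the owner's
`MultiscaleCombesThomasL2.prefactor_transfer` shape with `C = L^A`, `ακ = log L/R`; print: `R ≍ RM` ⟹ small rate loss, `L^A = L` into `B₀`.
[cite: Balaban1985BackgroundPropagators, Thm 3.1 (3.42) p.397; Balaban1984PropagatorsII, (2.1)-(2.2) p.224] -/
theorem prefactor_exchange_add {L : ℕ} (hL : 1 ≤ L) (e : St → ℕ) (hn : ∀ x, n x = L ^ e x) {R : ℝ} {A : ℕ} (κ : ℝ)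
    {x y : St} (hadd : |(e x : ℝ) - e y| ≤ A + sdist src tgt n x y / R) :
    Real.exp (-(κ * sdist src tgt n x y)) * ((n x : ℝ) * n y) ≤
      (L : ℝ) ^ A * Real.exp (-((κ - Real.log L / R) * sdist src tgt n x y)) * (n x : ℝ) ^ 2 := by
  have hscale := scale_le_scale_mul_exp_add src tgt n hL e hn (A := A) hadd
  have hnx0 : (0 : ℝ) ≤ n x := Nat.cast_nonneg _
  have hexp0 : 0 ≤ Real.exp (-(κ * sdist src tgt n x y)) := (Real.exp_pos _).le
  calc Real.exp (-(κ * sdist src tgt n x y)) * ((n x : ℝ) * n y)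
      ≤ Real.exp (-(κ * sdist src tgt n x y)) *
          ((n x : ℝ) * ((L : ℝ) ^ A * n x * Real.exp (Real.log L / R * sdist src tgt n x y))) :=
        mul_le_mul_of_nonneg_left (mul_le_mul_of_nonneg_left hscale hnx0) hexp0
    _ = (L : ℝ) ^ A * (Real.exp (-(κ * sdist src tgt n x y)) * Real.exp (Real.log L / R * sdist src tgt n x y)) * (n x : ℝ) ^ 2 := by
        ring
    _ = (L : ℝ) ^ A * Real.exp (-((κ - Real.log L / R) * sdist src tgt n x y)) * (n x : ℝ) ^ 2 := by
        have hexp : -(κ * sdist src tgt n x y) + Real.log L / R * sdist src tgt n x y =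
            -((κ - Real.log L / R) * sdist src tgt n x y) := by ring
        rw [← Real.exp_add, hexp]

/-- The additive exchange applied to a decay bound with a positive denominator. [folklore] -/
theorem decay_bound_exchange_add {L : ℕ} (hL : 1 ≤ L) (e : St → ℕ) (hn : ∀ x, n x = L ^ e x) {R : ℝ} {A : ℕ} (κ : ℝ)
    {μ : ℝ} (hμ : 0 < μ) {x y : St} (hadd : |(e x : ℝ) - e y| ≤ A + sdist src tgt n x y / R) {G : ℝ}
    (hG : G ≤ Real.exp (-(κ * sdist src tgt n x y)) * ((n x : ℝ) * n y) / μ) :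
    G ≤ (L : ℝ) ^ A * Real.exp (-((κ - Real.log L / R) * sdist src tgt n x y)) * (n x : ℝ) ^ 2 / μ :=
  hG.trans (div_le_div_of_nonneg_right (prefactor_exchange_add src tgt n hL e hn κ hadd) hμ.le)

/-- The landed bondwise clause of §2 is the `A = 0` case of the additive datum on a reachability class. [folklore] -/
theorem additive_of_bondwise (e : St → ℕ) {R : ℝ} (hR : 0 < R)
    (hgr : ∀ b, |(e (tgt b) : ℝ) - e (src b)| ≤ slen n (src b) (tgt b) / R) {x y : St}
    (hxy : (bondGraph src tgt).Reachable x y) :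
    |(e x : ℝ) - e y| ≤ ((0 : ℕ) : ℝ) + sdist src tgt n x y / R := by
  rw [Nat.cast_zero, zero_add]
  exact abs_sub_le_sdist_div src tgt n (fun z => (e z : ℝ)) hR hgr hxy

end Additive

end

end Summit.QuantumFields.BalabanUV.Beta.MultiscaleDistanceGraded
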